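import Mathlib
import Summits.AtomisticToContinuum.Crystallization.Theorems.GappedShellCensusFiveFoldRationingRStubFfrCountingZ

/-!
# Crux `GappedShellCensus.FiveFoldRationingR` (stmt-AtomisticToContinuum-18071), line `Sketch` —
# stub `stub_ffrVolGrowth` (VOLUME GROWTH of site counts)

Setting: `Y ⊆ ℝ³` with hard core `0.98 a` (`a > 0`) and `3a`-relatively dense (every point of space
is within `3a` of a site).  Conclusion: for every point `p` and every `n : ℕ` the closed ball
`B̄(p, 13 a n)` contains at least `n³` sites.

Proof.  Fix an orthonormal triple `e₀, e₁, e₂` and consider the `n³` grid points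
`q_{ijk} = p + 7a (i e₀ + j e₁ + k e₂)`, `0 ≤ i, j, k < n`.  By relative denseness each grid point
`q` has a site `φ q ∈ Y` with `dist q (φ q) ≤ 3a`.  Distinct grid points are `≥ 7a > 6a` apart
(`ffrCountZ_grid_sep`), so `φ` is injective on the grid.  Every chosen site lies within
`3a + 7a √(i² + j² + k²) ≤ 3a + 7 √3 a (n - 1) ≤ 3a + 13 a (n - 1) ≤ 13 a n` of `p`.  The hard core
makes `Y ∩ B̄(p, 13 a n)` finite (`finite_of_forall_le_dist_of_subset_closedBall`), so the index box
(of cardinality `n³`) injects into it and `n³ ≤ ncard (Y ∩ B̄(p, 13 a n))`.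
-/

noncomputable section

namespace Summit.AtomisticToContinuum.Crystallization.Theorems

open Literature.MathematicalPhysics.StatisticalMechanics

/-- Euclidean bound for a grid vector of mesh `7a`: if `i, j, k ≤ M` (and `a, M ≥ 0`) then
`‖(7a i) e₀ + (7a j) e₁ + (7a k) e₂‖ ≤ 13 a M` (since `49 · 3 = 147 ≤ 169 = 13²`). -/
theorem ffrVolGrowth_norm_le {e₀ e₁ e₂ : EuclideanSpace ℝ (Fin 3)} (h0 : ‖e₀‖ = 1)
    (h1 : ‖e₁‖ = 1) (h2 : ‖e₂‖ = 1) (h01 : inner ℝ e₀ e₁ = 0) (h02 : inner ℝ e₀ e₂ = 0)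
    (h12 : inner ℝ e₁ e₂ = 0) {a M : ℝ} (ha : 0 ≤ a) (hM : 0 ≤ M) {i j k : ℕ}
    (hi : (i : ℝ) ≤ M) (hj : (j : ℝ) ≤ M) (hk : (k : ℝ) ≤ M) :
    ‖(7 * a * i) • e₀ + (7 * a * j) • e₁ + (7 * a * k) • e₂‖ ≤ 13 * a * M := by
  refine le_of_sq_le_sq ?_ (by positivity)
  rw [ffrCountZ_norm_sq_combo h0 h1 h2 h01 h02 h12]
  have hi0 : (0 : ℝ) ≤ i := Nat.cast_nonneg _
  have hj0 : (0 : ℝ) ≤ j := Nat.cast_nonneg _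
  have hk0 : (0 : ℝ) ≤ k := Nat.cast_nonneg _
  have hi2 : (i : ℝ) ^ 2 ≤ M ^ 2 := pow_le_pow_left₀ hi0 hi 2
  have hj2 : (j : ℝ) ^ 2 ≤ M ^ 2 := pow_le_pow_left₀ hj0 hj 2
  have hk2 : (k : ℝ) ^ 2 ≤ M ^ 2 := pow_le_pow_left₀ hk0 hk 2
  have ha2 : 0 ≤ a ^ 2 := sq_nonneg a
  nlinarith [mul_le_mul_of_nonneg_left hi2 ha2, mul_le_mul_of_nonneg_left hj2 ha2,
    mul_le_mul_of_nonneg_left hk2 ha2, mul_nonneg ha2 (sq_nonneg M)]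

/-- **Stub VG (VOLUME GROWTH).** Hard core (`≥ 0.98a`) and relative denseness (`3a`) give cubic
growth of site counts: for every point `p` and `n : ℕ` the ball `B̄(p, 13 a n)` contains at least
`n³` sites (the `n³` grid points `p + 7a(i, j, k)`, `0 ≤ i, j, k < n`, have sites within `3a`,
pairwise distinct since `7a − 6a > 0`, all within `3a + 13a(n − 1) ≤ 13 a n` of `p`; finiteness of
`Y ∩ B̄` from the hard core). [folklore] -/
theorem stub_ffrVolGrowth :
    ∀ (Y : Set (EuclideanSpace ℝ (Fin 3))) (a : ℝ), 0 < a →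
      (∀ y ∈ Y, ∀ w ∈ Y, w ≠ y → a * (1 - 1 / 50) ≤ dist y w) →
      (∀ p : EuclideanSpace ℝ (Fin 3), ∃ y ∈ Y, dist p y ≤ 3 * a) →
      ∀ (p : EuclideanSpace ℝ (Fin 3)) (n : ℕ),
        (n : ℝ) ^ 3 ≤ ((Y ∩ Metric.closedBall p (13 * a * n)).ncard : ℝ) := by
  intro Y a ha hcore hRD p n
  obtain ⟨e₀, e₁, e₂, h0, h1, h2, h01, h02, h12⟩ := ffrCountZ_exists_orthoTriple
  choose φ hφY hφd using hRD
  -- the hard core makes `Y ∩ B̄(p, 13 a n)` finite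
  have hfin : (Y ∩ Metric.closedBall p (13 * a * n)).Finite := by
    refine finite_of_forall_le_dist_of_subset_closedBall (δ := a * (1 - 1 / 50)) (by positivity)
      ?_ Set.inter_subset_right
    rintro u ⟨huY, -⟩ w ⟨hwY, -⟩ huw
    exact hcore u huY w hwY (Ne.symm huw)
  -- the grid of mesh `7a` based at `p`
  obtain ⟨g, hg⟩ : ∃ g : ℕ × ℕ × ℕ → EuclideanSpace ℝ (Fin 3), ∀ ijk, g ijk =
      p + ((7 * a * ijk.1) • e₀ + (7 * a * ijk.2.1) • e₁ + (7 * a * ijk.2.2) • e₂) :=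
    ⟨_, fun _ => rfl⟩
  -- grid points followed by their sites are pairwise distinct
  have hinj : Set.InjOn (fun ijk => φ (g ijk))
      ((Finset.range n ×ˢ Finset.range n ×ˢ Finset.range n : Finset (ℕ × ℕ × ℕ)) :
        Set (ℕ × ℕ × ℕ)) := by
    intro u _ v _ huv
    have huv' : φ (g u) = φ (g v) := huv
    by_contra hne
    have hsep := ffrCountZ_grid_sep h0 h1 h2 h01 h02 h12 p (7 * a) hne
    rw [← hg, ← hg] at hsep
    have : dist (g u) (g v) ≤ 6 * a :=
      calc dist (g u) (g v) ≤ dist (g u) (φ (g u)) + dist (φ (g u)) (g v) := dist_triangle _ _ _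
        _ ≤ 3 * a + 3 * a := by
          gcongr
          · exact hφd (g u)
          · rw [huv', dist_comm]
            exact hφd (g v)
        _ = 6 * a := by ring
    linarith
  -- and they lie in the ball `B̄(p, 13 a n)`
  have hmem : ∀ ijk ∈ ((Finset.range n ×ˢ Finset.range n ×ˢ Finset.range n :
      Finset (ℕ × ℕ × ℕ)) : Set (ℕ × ℕ × ℕ)),
      (fun ijk => φ (g ijk)) ijk ∈ Y ∩ Metric.closedBall p (13 * a * n) := by
    intro ijk hijk
    rw [Finset.mem_coe, Finset.mem_product, Finset.mem_product, Finset.mem_range, Finset.mem_range,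
      Finset.mem_range] at hijk
    refine ⟨hφY _, ?_⟩
    rw [Metric.mem_closedBall]
    have hi : (ijk.1 : ℝ) + 1 ≤ n := by exact_mod_cast Nat.lt_iff_add_one_le.mp hijk.1
    have hj : (ijk.2.1 : ℝ) + 1 ≤ n := by exact_mod_cast Nat.lt_iff_add_one_le.mp hijk.2.1
    have hk : (ijk.2.2 : ℝ) + 1 ≤ n := by exact_mod_cast Nat.lt_iff_add_one_le.mp hijk.2.2
    have hM : (0 : ℝ) ≤ n - 1 := by
      have : (0 : ℝ) ≤ ijk.1 := Nat.cast_nonneg _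
      linarith
    have hgn : dist (g ijk) p ≤ 13 * a * (n - 1) := by
      rw [hg, dist_eq_norm, add_sub_cancel_left]
      exact ffrVolGrowth_norm_le h0 h1 h2 h01 h02 h12 ha.le hM (by linarith) (by linarith)
        (by linarith)
    have htri : dist (φ (g ijk)) p ≤ dist (φ (g ijk)) (g ijk) + dist (g ijk) p :=
      dist_triangle _ _ _
    rw [dist_comm (φ (g ijk)) (g ijk)] at htri
    linarith [hφd (g ijk)]
  -- count
  have hle : ((Finset.range n ×ˢ Finset.range n ×ˢ Finset.range n : Finset (ℕ × ℕ × ℕ)) :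
      Set (ℕ × ℕ × ℕ)).ncard ≤ (Y ∩ Metric.closedBall p (13 * a * n)).ncard :=
    Set.ncard_le_ncard_of_injOn _ hmem hinj hfin
  rw [Set.ncard_coe_finset, Finset.card_product, Finset.card_product, Finset.card_range] at hle
  have hcast : ((n * (n * n) : ℕ) : ℝ) ≤ ((Y ∩ Metric.closedBall p (13 * a * n)).ncard : ℝ) := by
    exact_mod_cast hle
  push_cast at hcast
  have hcube : (n : ℝ) ^ 3 = n * (n * n) := by ring
  linarith

end Summit.AtomisticToContinuum.Crystallization.Theorems

end
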